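import Summits.CriticalPhenomena.PercolationContinuityZ3.Theses.PercNonProliferation
import Literature.Probability.Percolation.SharpnessDCTProofs

/-!
# `SpanningPiecesCount` — deterministic Cauchy–Schwarz over spanning pieces

Route `CriticalPhenomena/PercNonProliferation`, item `stmt-CriticalPhenomena-4448` (support,
rank 9).

For a bond configuration `ω ⊆ E(ℤ³)` call two sites *joined* when `ω ∈ openConnIn ↑B(2n) x y`
(an open path inside the free box `B(2n)`); this is an equivalence relation on the sites of
`B(2n) ⊇ B(n)`. Every percolating site `x ∈ B(n)` is a *spanning representative*: its infinite
open cluster leaves the finite box `B(2n)`, and the first exit of an open path does so through a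
lattice edge (here `ω ⊆ E(ℤ³)` is used) from a site of the inner vertex boundary `∂⁻B(2n)`, the
initial segment staying inside `B(2n)`. Hence if no `M + 1` sites of `B(n)` are pairwise unjoined
spanning representatives, the percolating sites of `B(n)` fall into `k ≤ M` classes
`P_1, …, P_k`, and Cauchy–Schwarz gives
`(#{x ∈ B(n) : x ↔ ∞})² = (Σ_r |P_r|)² ≤ k Σ_r |P_r|² ≤ M · #{(x, y) ∈ B(n)² : x ↔ y in B(2n)}`
since `P_r × P_r` consists of joined pairs. This is the pointwise skeleton of the
Aizenman–Duminil-Copin–Sidoravicius density bound (CMP 2015, proof of Thm 3.1), transplanted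
from the bulk to free boxes at the price of the factor `N_n ≤ M` (Aizenman 1997, App. A).

Main results:
* `sq_card_le_mul_card_filter_of_not_exists` — the abstract counting lemma (classes of an
  equivalence relation on a finite set, no `M + 1` pairwise unrelated good elements);
* `exists_innerBoundary_openConnIn_of_percolatesAt` (private; the `box` case is the public
  lemma `exists_openConnIn_innerBoundary_of_percolatesAt` of
  `Theorems/PercShatteringRaceRaceLemma.lean`) — percolating sites of a finite `Λ` are joined
  inside `Λ` to `∂⁻Λ`, so percolating sites of `B(n) ⊆ B(2n)` are spanning representatives of
  `B(2n)`;
* `spanningPiecesCount_proof : SpanningPiecesCount`.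
-/

namespace Summit.CriticalPhenomena.PercolationContinuityZ3.Theorems

open scoped Classical
open Finset Literature.Probability.Percolation Literature.Probability.LatticeModels

/-- **Counting lemma.** Let `r` be reflexive on `P ⊆ B`, symmetric and transitive, let every
element of `P` be `good`, and suppose there are no `M + 1` good elements of `B` that are pairwise
`r`-unrelated. Then `(#P)² ≤ M · #{q ∈ B × B | r q.1 q.2}`: the `r`-classes of `P` number at most
`M`, `#P = Σ_c #c`, `(Σ_c #c)² ≤ (#classes) Σ_c (#c)²` (Cauchy–Schwarz) and the sets `c × c` are
disjoint sets of related pairs. [folklore] -/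
theorem sq_card_le_mul_card_filter_of_not_exists {α : Type*} (B P : Finset α) (r : α → α → Prop)
    (good : α → Prop) (M : ℕ) (hPB : P ⊆ B) (hrefl : ∀ x ∈ P, r x x)
    (hsymm : ∀ x y, r x y → r y x) (htrans : ∀ x y z, r x y → r y z → r x z)
    (hgood : ∀ x ∈ P, good x)
    (hno : ¬ ∃ x : Fin (M + 1) → α,
      (∀ i, x i ∈ B) ∧ (∀ i, good (x i)) ∧ ∀ i j, i ≠ j → ¬ r (x i) (x j)) :
    (#P) ^ 2 ≤ M * #((B ×ˢ B).filter fun q => r q.1 q.2) := by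
  -- the class of `x` inside `P`
  obtain ⟨cls, hcls⟩ : ∃ cls : α → Finset α, ∀ x, cls x = P.filter fun y => r x y :=
    ⟨_, fun _ => rfl⟩
  have mem_cls : ∀ x a, a ∈ cls x ↔ a ∈ P ∧ r x a := fun x a => by rw [hcls, mem_filter]
  have cls_eq : ∀ x y, r x y → cls x = cls y := by
    intro x y hxy
    ext a
    rw [mem_cls, mem_cls]
    exact and_congr_right fun _ =>
      ⟨fun h => htrans _ _ _ (hsymm _ _ hxy) h, fun h => htrans _ _ _ hxy h⟩
  have mem_cls_self : ∀ x ∈ P, x ∈ cls x := fun x hx => (mem_cls x x).2 ⟨hx, hrefl x hx⟩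
  -- the fibre of `cls` over a class `c`
  obtain ⟨fib, hfib⟩ : ∃ fib : Finset α → Finset α, ∀ c, fib c = P.filter fun a => cls a = c :=
    ⟨_, fun _ => rfl⟩
  have mem_fib : ∀ c a, a ∈ fib c ↔ a ∈ P ∧ cls a = c := fun c a => by rw [hfib, mem_filter]
  -- `#P = Σ_{c} #(fib c)` over the set `T` of classes
  have hcardP : #P = ∑ c ∈ P.image cls, #(fib c) := by
    rw [card_eq_sum_card_image cls P]
    exact Finset.sum_congr rfl fun c _ => by rw [hfib]
  -- at most `M` classes
  have hT : #(P.image cls) ≤ M := by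
    by_contra hlt
    have hle : M + 1 ≤ #(P.image cls) := by omega
    -- `M + 1` distinct classes and representatives of them
    have hrep : ∀ i : Fin (M + 1),
        ∃ x ∈ P, cls x = ((P.image cls).equivFin.symm (Fin.castLE hle i)).1 := fun i =>
      mem_image.1 ((P.image cls).equivFin.symm (Fin.castLE hle i)).2
    choose x hxP hxcls using hrep
    refine hno ⟨x, fun i => hPB (hxP i), fun i => hgood _ (hxP i), fun i j hij hr => hij ?_⟩
    have h1 : (P.image cls).equivFin.symm (Fin.castLE hle i) =
        (P.image cls).equivFin.symm (Fin.castLE hle j) :=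
      Subtype.ext (by rw [← hxcls i, ← hxcls j]; exact cls_eq _ _ hr)
    exact Fin.castLE_injective hle ((P.image cls).equivFin.symm.injective h1)
  -- `fib c × fib c` consists of related pairs of `B × B`
  have hfib_sub : ∀ c ∈ P.image cls, fib c ×ˢ fib c ⊆ (B ×ˢ B).filter fun q => r q.1 q.2 := by
    intro c _ q hq
    rw [mem_product, mem_fib, mem_fib] at hq
    obtain ⟨⟨h1P, h1c⟩, h2P, h2c⟩ := hq
    rw [mem_filter, mem_product]
    refine ⟨⟨hPB h1P, hPB h2P⟩, ?_⟩
    have h2 : q.2 ∈ cls q.1 := by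
      rw [h1c, ← h2c]
      exact mem_cls_self _ h2P
    exact ((mem_cls _ _).1 h2).2
  -- and these sets are pairwise disjoint
  have hdisj : (↑(P.image cls) : Set (Finset α)).PairwiseDisjoint fun c => fib c ×ˢ fib c := by
    intro c₁ _ c₂ _ hne
    rw [Function.onFun, Finset.disjoint_left]
    intro q hq₁ hq₂
    rw [mem_product, mem_fib] at hq₁ hq₂
    exact hne (hq₁.1.2.symm.trans hq₂.1.2)
  have hsum : ∑ c ∈ P.image cls, #(fib c) ^ 2 ≤ #((B ×ˢ B).filter fun q => r q.1 q.2) :=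
    calc ∑ c ∈ P.image cls, #(fib c) ^ 2 = ∑ c ∈ P.image cls, #(fib c ×ˢ fib c) :=
          Finset.sum_congr rfl fun c _ => by rw [card_product, sq]
      _ = #((P.image cls).biUnion fun c => fib c ×ˢ fib c) := (card_biUnion hdisj).symm
      _ ≤ #((B ×ˢ B).filter fun q => r q.1 q.2) :=
          card_le_card (Finset.biUnion_subset.2 hfib_sub)
  calc (#P) ^ 2 = (∑ c ∈ P.image cls, #(fib c)) ^ 2 := by rw [hcardP]
    _ ≤ #(P.image cls) * ∑ c ∈ P.image cls, #(fib c) ^ 2 := sq_sum_le_card_mul_sum_sq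
    _ ≤ M * #((B ×ˢ B).filter fun q => r q.1 q.2) := Nat.mul_le_mul hT hsum

/-- **Percolating sites are spanning representatives.** For `ω ⊆ E(ℤ^d)`, if the open cluster of
a site `x ∈ Λ` (`Λ` a finite set of sites) is infinite, then `x` is joined inside `Λ` to a site of
the inner vertex boundary `∂⁻Λ`: an open path from `x` to a site outside `Λ` has a first exit
edge `a ∼ b`, `a ∈ Λ`, `b ∉ Λ`, which is a lattice edge, so `a ∈ ∂⁻Λ`, and its initial segment up
to `a` stays in `Λ` (Grimmett 1999, §1.4). Private copy (general finite `Λ`) of the `box` lemma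
`exists_openConnIn_innerBoundary_of_percolatesAt` of `Theorems/PercShatteringRaceRaceLemma.lean`.
[folklore] -/
private theorem exists_innerBoundary_openConnIn_of_percolatesAt {d : ℕ} {Λ : Finset (Site d)}
    {x : Site d} (hx : x ∈ Λ) {ω : BondConfig (Site d)} (hω : ω ⊆ (zdGraph d).edgeSet)
    (h : ω ∈ percolatesAt x) :
    ∃ y ∈ innerBoundary (zdGraph d) Λ, ω ∈ openConnIn (↑Λ : Set (Site d)) x y := by
  obtain ⟨z, hz, hzn⟩ : ∃ z ∈ openCluster ω x, z ∉ Λ := by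
    by_contra hcon
    refine h (Λ.finite_toSet.subset fun z hz => ?_)
    by_contra hzn
    exact hcon ⟨z, hz, hzn⟩
  obtain ⟨a, b, ha, hb, -, hab, hpa⟩ :=
    (DCT16.pathIn_univ_of_reachable hz).exit (R := (↑Λ : Set (Site d))) (Finset.mem_coe.2 hx)
      (fun h' => hzn (Finset.mem_coe.1 h'))
  refine ⟨a, ?_, ?_⟩
  · rw [mem_innerBoundary_iff]
    exact ⟨Finset.mem_coe.1 ha, b, fun h' => hb (Finset.mem_coe.2 h'),
      DCT16.adj_of_openGraph_adj hω hab⟩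
  · rw [DCT16.mem_openConnIn_iff_pathIn]
    exact hpa.mono Set.inter_subset_left

/-- **`SpanningPiecesCount`** (item `stmt-CriticalPhenomena-4448`, exact route statement): for
`ω ⊆ E(ℤ³)`, if there are no `M + 1` sites of `B(n)` pairwise unjoined inside `B(2n)` and each
joined inside `B(2n)` to `∂⁻B(2n)`, then
`(#{x ∈ B(n) : |C(x)| = ∞})² ≤ M · #{(x, y) ∈ B(n)² : x ↔ y inside B(2n)}`. [folklore] -/
theorem spanningPiecesCount_proof :
    Summit.CriticalPhenomena.PercolationContinuityZ3.Theses.PercNonProliferation.SpanningPiecesCount := by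
  unfold Summit.CriticalPhenomena.PercolationContinuityZ3.Theses.PercNonProliferation.SpanningPiecesCount
  intro M n ω hω hno
  have hsub : box 3 n ⊆ box 3 (2 * n) := box_mono 3 (by omega)
  refine sq_card_le_mul_card_filter_of_not_exists (box 3 n)
    ((box 3 n).filter fun x => ω ∈ percolatesAt x)
    (fun x y => ω ∈ openConnIn (↑(box 3 (2 * n)) : Set (Site 3)) x y)
    (fun x => ∃ y ∈ innerBoundary (zdGraph 3) (box 3 (2 * n)),
      ω ∈ openConnIn (↑(box 3 (2 * n)) : Set (Site 3)) x y)
    M (filter_subset _ _) ?_ ?_ ?_ ?_ hno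
  · intro x hx
    have hxS : x ∈ (↑(box 3 (2 * n)) : Set (Site 3)) :=
      Finset.mem_coe.2 (hsub (mem_filter.1 hx).1)
    exact ⟨hxS, hxS, SimpleGraph.Reachable.refl _⟩
  · rintro x y ⟨hx, hy, h⟩
    exact ⟨hy, hx, h.symm⟩
  · rintro x y z ⟨hx, hy, h⟩ ⟨_, hz, h'⟩
    exact ⟨hx, hz, h.trans h'⟩
  · intro x hx
    exact exists_innerBoundary_openConnIn_of_percolatesAt (hsub (mem_filter.1 hx).1) hω
      (mem_filter.1 hx).2

end Summit.CriticalPhenomena.PercolationContinuityZ3.Theorems
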